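import Summits.BirchSwinnertonDyer.BirchSwinnertonDyer.Theses.ByReductionTypeAtTwo
import Summits.BirchSwinnertonDyer.BirchSwinnertonDyer.Theorems.ByReductionTypeAtTwoSupersingularUniformFlatLineFineMu
import Summits.BirchSwinnertonDyer.BirchSwinnertonDyer.Theorems.ByReductionTypeAtTwoSupersingularFlatLocalDataOfHondaSystem
import Summits.BirchSwinnertonDyer.Rank1Residual.F1Sign2.HondaSystemAtTwo
import Summits.BirchSwinnertonDyer.Rank1Residual.P2.EmptyCellsAtTwo
import Summits.BirchSwinnertonDyer.Rank1Residual.GaloisImage.KuriharaSelmerShaBookkeeping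
import Literature.NumberTheory.EllipticCurves.Kato2004.EulerSystemBoundFineSelmerTwo
import Literature.NumberTheory.EllipticCurves.Kato2004.IwasawaH1FreeOfNoRationalTorsionProofs
import Literature.NumberTheory.EllipticCurves.Kato2004.MainConjecturePrimeTDoorProofs
import Literature.NumberTheory.EllipticCurves.IwasawaAlgebraCharIdealProofs
import Literature.NumberTheory.EllipticCurves.TateModuleFreeProofs
import Literature.NumberTheory.EllipticCurves.Rank1Residual.Predicates
import HarnessLib

/-!
# Route `ByReductionTypeAtTwo` (rung K4), crux `SupersingularRankZeroAtTwo` (item stmt-BirchSwinnertonDyer-19097): **THE ZETA LINE AT `2`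
# FROM ITS FINITE-INDEX SHADOW** — on the habitat `GoodSS W 2` the module `𝐇¹_Γ(T₂W)` is `Λ = ℤ₂⟦T⟧`-FREE (tree theorem, fed by
# `W(ℚ)[2] = 0`), so Kato's §13.14 runs AT `p = 2` for the `Δ`-trivial component: finite-index zeta data `T^m • wp = 2^m • wT`
# saturate to an INTEGRAL generator `s₀` carrying the value clause and the local Euler-multiple clause — the conclusion is, token
# for token, the pair of conjuncts «`G ∈ Submodule.map (P.subtype ∘ₗ loc) Z`» ∧ ZL2 of the registered `stub_flatPackage` (v2.16)

HONEST FRAMING (cell `bsd-f1-sign2`, run/shared/lean/pub/bsd-f1-sign2/, seat `-imc` g36 = planner-of-record, LENS = Iwasawa main conjecture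
«what Kato's divisibility gives at 2 and where the 2-adic error terms sit»; deliverable D-imc-89; companion crux workfile
`Cruxes/SupersingularRankZeroAtTwo/D89ZetaLineIntegralAtTwo.lean` holds the statement-level corollary `FlatPackageAtTwoFI ↔ FlatPackageAtTwo`):
THEOREMS ONLY (no definition, no named fact, no instance, no `sorry`); pure `Λ`-algebra plus two tree theorems composed BY NAME; UNCONDITIONAL.
Closes no stub: it is the HELPER a prover of `stub_flatPackage`'s zeta-line conjuncts ends with (director-bsd (869)(a): `Cruxes` modules are not
importable in practice, helpers land under `Theorems/`).  Nothing booked; 19097 OPEN; BSD is proved for no curve by this file.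

THE LENS FINDING (REF1 §490 rider R490c gap (1) «2-integrality of the Néron-normalised zeta line in `𝐇¹(T₂W)`»).  Print: Kato Thm. 12.4 (2) `𝐇¹(T)`
torsion-free (all `p`), (3) free of rank one «if `p ≠ 2`» and `T/𝔪T` irreducible; Thm. 12.6 `Z(f,T)/Z` finite (all `p`, §13.12); Thm. 12.5 (4)
`Z(f,T) ⊂ 𝐇¹(T)` «assume `p ≠ 2`», whose whole proof §13.14 is «finite index ⟹ `Z(f,T)_𝔭 ⊂ 𝐇¹(T)_𝔭` at every height-one `𝔭`; `𝐇¹(T)` free ⟹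
`Z(f,T) ⊂ 𝐇¹(T)`» (= [Wuthrich2014] Lemma 12, stated for odd `p`; his Thm. 13 is the odd-`p` good-reduction integrality of the `Δ`-trivial
corestriction `z⁰ ∈ 𝐇¹(T)⁰`).  The `p ≠ 2` of 12.4 (3) lives in the FULL ring `O_λ[[ℤ₂^×]] = O_λ[ℤ/2]⟦T⟧` (§12.1: not a product at `p = 2`, cokernel
killed by `2`; (12.1.4) `Λ_𝔭` not a DVR when `2 ∈ 𝔭`).  BSD over `ℚ_∞ = ℚ(ζ_{2^∞})⁺` sees only the `Δ`-trivial component over the REGULAR ring `ℤ₂⟦T⟧` =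
the tree's `Kato2004.IwasawaH1Data W 2 κ γ`, for which the tree PROVES Kato's §13.8 freeness at every `p` from `W(ℚ)[p] = 0`
(`Kato2004.IwasawaH1Data.moduleFree_of_torsionBy_eq_bot`); and `GoodSS W 2 ⟹ W[2]` irreducible (`Rank1Residual.P2.irr_two_of_goodSS_two`)
`⟹ W(ℚ)[2] = 0` (`Rank1Residual.GaloisImage.SelmerSha.torsionBy_point_eq_bot`).  HENCE gap (1) is NOT a beyond-print input on the habitat; the
2-adic error terms of the zeta line sit in the value clause (unit / isogeny index `ϖ`, ♭-explicit reciprocity at `2`), in `μ` at `(2)` and in the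
cusp multiplier at `𝔭 ∌ 2` — the surviving hypotheses `hval`, `hloc` below — not in integrality.

WHAT: §1 `torsionBy_two_eq_bot_of_goodSS_two`, ★ `moduleFree_iwasawaH1_of_goodSS_two` (Kato 12.4 (3) AT `2` for the pinned module, by name);
§2 `exists_eq_pow_smul_of_smul_eq_pow_smul` (`r` prime, `r ∤ x`, `M` free: `x • a = r^n • b ⟹ a ∈ r^n M`), `eq_smul_of_smul_eq_pow_smul`,
`saturate_unique`, `not_C_dvd_X_pow`; §3 ★ `zetaLine_of_finiteIndex` (any `p`, any free torsion-free `Λ`-module, any class predicate);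
★★ `zetaLineAtTwo_of_finiteIndex` (the habitat specialisation: conclusion = the registry's two zeta-line conjuncts verbatim in shape);
§4 `saturation_fails_without_freeness` (TIGHTNESS: in the torsion-free non-free `𝔪 = (2,T)`, `T • 2 = 2 • T` but `2 ∉ 2𝔪` — Wuthrich's Lemma 10
«image equal to the maximal ideal» alternative is exactly where §13.14 stops).

References: [Kato2004Asterisque] §12.1 (12.1.2)–(12.1.4) (pp. 219–220), Thm. 12.4 (p. 221), Thm. 12.5 (4), Thm. 12.6 (p. 222), §13.8 (pp. 228–229),
§13.12 (pp. 231–233), §13.14 (p. 234); [Wuthrich2014] §3.1 (Lemmas 9, 10), §3.3 (Lemma 12, Thm. 13, proof of Prop. 15); [Delbourgo2008]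
App. A, Thm. A.2 and Remark (b) (pp. 337–342); [BourbakiAC5to7] Ch. VII §4 no. 2; [Mazur1977] Ch. III §5; tree:
`Kato2004/IwasawaH1FreeOfNoRationalTorsionProofs.lean`, `Kato2004/DivisibilityInputsZetaLine.lean` (the ordinary odd-`p` finite-index precedent (F1a)),
`Kato2004/EulerSystemBoundFineSelmerTwo.lean`, `Rank1Residual/P2/EmptyCellsAtTwo.lean`, `Rank1Residual/GaloisImage/KuriharaSelmerShaBookkeeping.lean`,
`IwasawaAlgebraCharIdealProofs.lean`.
-/

set_option autoImplicit false
set_option linter.dupNamespace false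

noncomputable section

open scoped Classical MatrixGroups ModularForm NumberField
open NumberField IsDedekindDomain CongruenceSubgroup WeierstrassCurve PowerSeries
open Literature.NumberTheory.EllipticCurves Literature.NumberTheory.EllipticCurves.IwasawaDual
  Literature.NumberTheory.EllipticCurves.Sprung2012 Literature.NumberTheory.EllipticCurves.Sprung2017
  Literature.NumberTheory.EllipticCurves.ModularForms
  Literature.NumberTheory.EllipticCurves.Rank1Residual Literature.NumberTheory.EllipticCurves.Rank1Residual.Typed
  Literature.NumberTheory.EllipticCurves.Kobayashi2003 Literature.NumberTheory.GaloisRepresentations ZpExtension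
open Summit.BirchSwinnertonDyer.Rank1Residual Summit.BirchSwinnertonDyer.Rank1Residual.Supersingular

namespace Summit.BirchSwinnertonDyer.BirchSwinnertonDyer.Theorems.ZetaLineFI

/-! ## §1 The habitat freeness: `GoodSS W 2 ⟹ W(ℚ)[2] = 0 ⟹ 𝐇¹_Γ(T₂W)` is Λ-free (tree theorems, composed) -/

/-- **No rational `2`-torsion at a good supersingular `2`** (`(2 : ℕ)`-cast dialect of the Kato file): `GoodSS W 2 ⟹ ρ̄_{W,2}` irreducible
(`P2.irr_two_of_goodSS_two`) `⟹ W(ℚ)[2] = 0` (`SelmerSha.torsionBy_point_eq_bot`, `K = 1`). [cite: Mazur1977, Ch. III §5 (p. 157)]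
[cite: SilvermanAEC2009, IV.6.1 and VII.2] -/
theorem torsionBy_two_eq_bot_of_goodSS_two (W : WeierstrassCurve ℚ) [W.IsElliptic] [W.IsGloballyMinimal]
    (hss : GoodSS W 2) : AddSubgroup.torsionBy W.toAffine.Point ((2 : ℕ) : ℤ) = ⊥ := by
  have h := Summit.BirchSwinnertonDyer.Rank1Residual.GaloisImage.SelmerSha.torsionBy_point_eq_bot W 2
    (Summit.BirchSwinnertonDyer.Rank1Residual.P2.irr_two_of_goodSS_two W hss) 1
  simpa using h

/-- **K89-F.  On every curve of the crux, `𝐇¹_Γ(T₂W)` is a FREE `Λ = ℤ₂⟦T⟧`-module** — Kato Thm. 12.4 (3) AT `p = 2` for the tree's pinned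
`Δ`-trivial component: the tree theorem `IwasawaH1Data.moduleFree_of_torsionBy_eq_bot` (every `p`, hypothesis `W(ℚ)[p] = 0`; regular sequence
`(T, p)` on `Λ = ℤ_p⟦T⟧`, §13.8 verbatim) fed with `torsionBy_two_eq_bot_of_goodSS_two`.  Print states clause (3) only for `p ≠ 2` — there for the
FULL `O_λ[[ℤ₂^×]]`-module, which this does not address. [cite: Kato2004Asterisque, Thm. 12.4 (3) (p. 221) and §13.8 (pp. 228–229)] -/
theorem moduleFree_iwasawaH1_of_goodSS_two (W : WeierstrassCurve ℚ) [W.IsElliptic] [W.IsGloballyMinimal]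
    [ContinuousSMul ℤ_[2] (W.tateModule 2)] (hss : GoodSS W 2) {κ : ZpExtension ℚ 2}
    {γ : Field.absoluteGaloisGroup ℚ} (hκ : κ.IsCyclotomic) (hγ : κ.IsTopGenerator γ)
    (I : Kato2004.IwasawaH1Data W 2 κ γ) : Module.Free (IwasawaAlgebra 2) I.H :=
  Kato2004.IwasawaH1Data.moduleFree_of_torsionBy_eq_bot hκ hγ I (torsionBy_two_eq_bot_of_goodSS_two W hss)

/-! ## §2 `p`-saturation in a free module over a domain (the algebra of Kato §13.14 in finite-index coordinates) -/

/-- **Saturation.**  `R` a domain, `r ∈ R` prime, `r ∤ x`, `M` a FREE `R`-module: `x • a = r^n • b ⟹ a ∈ r^n • M`.  (Coordinates in a basis: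
`r^n ∣ x·aᵢ ⟹ r^n ∣ aᵢ` by `Prime.pow_dvd_of_dvd_mul_left`.)  With `R = Λ`, `r = p`, `x = T^m` this is «`𝔪^m z ⊂ 𝐇¹ ⟹ z ∈ 𝐇¹`» for free `𝐇¹`,
i.e. the step «`Z(f,T)_𝔭 ⊂ 𝐇¹(T)_𝔭` for all height-one `𝔭` + `𝐇¹(T)` free `⟹ Z(f,T) ⊂ 𝐇¹(T)`» of §13.14. [cite: Kato2004Asterisque, §13.14 (p. 234)]
[cite: BourbakiAC5to7, Ch. VII §4 no. 2] -/
theorem exists_eq_pow_smul_of_smul_eq_pow_smul {R : Type*} [CommRing R] [IsDomain R] {M : Type*}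
    [AddCommGroup M] [Module R M] [Module.Free R M] {r x : R} (hr : Prime r) (hx : ¬ r ∣ x) (n : ℕ)
    {a b : M} (h : x • a = r ^ n • b) : ∃ c : M, a = r ^ n • c := by
  classical
  let B := Module.Free.chooseBasis R M
  have hcoord : ∀ i, r ^ n ∣ B.repr a i := by
    intro i
    have hi : x * B.repr a i = r ^ n * B.repr b i := by
      have := congrArg (fun m : M => B.repr m i) h
      simpa [map_smul, Finsupp.smul_apply, smul_eq_mul] using this
    exact hr.pow_dvd_of_dvd_mul_left n hx ⟨B.repr b i, hi⟩
  choose q hq using hcoord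
  have hsupp : ∀ i, q i ≠ 0 → i ∈ (B.repr a).support := by
    intro i hqi
    rw [Finsupp.mem_support_iff, hq i]
    exact mul_ne_zero (pow_ne_zero n hr.ne_zero) hqi
  let f := Finsupp.onFinset (B.repr a).support q hsupp
  refine ⟨B.repr.symm f, ?_⟩
  apply B.repr.injective
  ext i
  simp [f, Finsupp.onFinset_apply, hq i, map_smul, Finsupp.smul_apply, smul_eq_mul]

/-- **The companion coordinate**: if moreover `M` is `R`-torsion-free (`r ≠ 0`), the saturating element also carries `b`: `b = x • c`.
[cite: Kato2004Asterisque, §13.14 (p. 234)] -/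
theorem eq_smul_of_smul_eq_pow_smul {R : Type*} [CommRing R] [IsDomain R] {M : Type*} [AddCommGroup M]
    [Module R M] [Module.IsTorsionFree R M] {r x : R} (hr0 : r ≠ 0) (n : ℕ) {a b c : M} (h : x • a = r ^ n • b)
    (hc : a = r ^ n • c) : b = x • c := by
  have key : r ^ n • b = r ^ n • (x • c) := by rw [← h, hc, smul_comm]
  exact smul_right_injective M (pow_ne_zero n hr0) key

/-- **Uniqueness of the saturating element** (torsion-freeness). [folklore] -/
theorem saturate_unique {R : Type*} [CommRing R] [IsDomain R] {M : Type*} [AddCommGroup M]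
    [Module R M] [Module.IsTorsionFree R M] {r : R} (hr0 : r ≠ 0) (n : ℕ) {a c c' : M} (hc : a = r ^ n • c)
    (hc' : a = r ^ n • c') : c = c' :=
  smul_right_injective M (pow_ne_zero n hr0) (hc.symm.trans hc')

/-- `C p ∤ T^m` in `Λ = ℤ_p⟦T⟧` (the `m`-th coefficient of `T^m` is `1`, not a multiple of `p`). [cite: Washington1997, §13.1] -/
theorem not_C_dvd_X_pow (p : ℕ) [Fact p.Prime] (m : ℕ) :
    ¬ (PowerSeries.C (p : ℤ_[p]) : IwasawaAlgebra p) ∣ (PowerSeries.X : IwasawaAlgebra p) ^ m := by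
  intro h
  rw [Literature.NumberTheory.EllipticCurves.PowerSeries.C_dvd_iff_forall_dvd_coeff] at h
  have h1 : (p : ℤ_[p]) ∣ 1 := by simpa [PowerSeries.coeff_X_pow] using h m
  exact (PadicInt.prime_p (p := p)).not_unit (isUnit_of_dvd_one h1)

/-! ## §3 K89-K — the kernel: FZ2-data + freeness ⟹ the ZL2 clause (any `p`, any free torsion-free `Λ`-module, any class predicate `E`) -/

/-- **K89-K (the zeta line from its finite-index shadow).**  `Λ = ℤ_p⟦T⟧`, `H` a FREE `Λ`-torsion-free `Λ`-module (`𝐇¹_Γ(T_pW)`: §1 and the tree's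
`IwasawaH1Data.isTorsionFree`), `loc : H → P ⊂ Λ` linear (`Col♭ ∘ loc₂` in the line), `E` any predicate on `H` («genuine Euler-system class»),
`G ∈ Λ`.  From `T^m • wp = p^m • wT`, `p^m·G ∈ loc(Λ·wp)` and the local clause for `wp` at the height-one `𝔭 ∌ p` we get `s₀` with `wp = p^m • s₀`,
`wT = T^m • s₀`, `G ∈ loc(Λ·s₀)` and the SAME local clause for `s₀` (multiplier `M·p^m ∉ 𝔭`).  With `Z := Λ·s₀` the last two outputs are LITERALLY the
F3-membership and the ZL2 conjunct of the registry's `FlatPackageAtTwo`. [cite: Kato2004Asterisque, Thm. 12.6 (p. 222) and §13.14 (p. 234)] -/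
theorem zetaLine_of_finiteIndex {p : ℕ} [Fact p.Prime] {H : Type*} [AddCommGroup H] [Module (IwasawaAlgebra p) H]
    [Module.Free (IwasawaAlgebra p) H] [Module.IsTorsionFree (IwasawaAlgebra p) H]
    (P : Submodule (IwasawaAlgebra p) (IwasawaAlgebra p)) (loc : H →ₗ[IwasawaAlgebra p] P) (E : H → Prop)
    (G : IwasawaAlgebra p) (m : ℕ) (wp wT : H)
    (hw : (PowerSeries.X : IwasawaAlgebra p) ^ m • wp = (PowerSeries.C (p : ℤ_[p]) : IwasawaAlgebra p) ^ m • wT)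
    (hval : (PowerSeries.C (p : ℤ_[p]) : IwasawaAlgebra p) ^ m * G ∈
      Submodule.map (P.subtype ∘ₗ loc) (Submodule.span (IwasawaAlgebra p) {wp}))
    (hloc : ∀ 𝔭 : PrimeSpectrum (IwasawaAlgebra p), 𝔭.asIdeal.height = 1 →
      PowerSeries.C (p : ℤ_[p]) ∉ 𝔭.asIdeal →
      ∃ (M : IwasawaAlgebra p) (s : H), M ∉ 𝔭.asIdeal ∧ E s ∧ s ≠ 0 ∧ M • wp = s) :
    ∃ s₀ : H, wp = (PowerSeries.C (p : ℤ_[p]) : IwasawaAlgebra p) ^ m • s₀ ∧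
      wT = (PowerSeries.X : IwasawaAlgebra p) ^ m • s₀ ∧
      G ∈ Submodule.map (P.subtype ∘ₗ loc) (Submodule.span (IwasawaAlgebra p) {s₀}) ∧
      ∀ 𝔭 : PrimeSpectrum (IwasawaAlgebra p), 𝔭.asIdeal.height = 1 →
        PowerSeries.C (p : ℤ_[p]) ∉ 𝔭.asIdeal →
        ∃ (M : IwasawaAlgebra p) (s : H), M ∉ 𝔭.asIdeal ∧ E s ∧ s ≠ 0 ∧ M • s₀ = s := by
  have hprime : Prime (PowerSeries.C (p : ℤ_[p]) : IwasawaAlgebra p) :=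
    Literature.NumberTheory.EllipticCurves.IwasawaAlgebra.prime_C p
  set ϖ : IwasawaAlgebra p := PowerSeries.C (p : ℤ_[p]) with hϖ
  have hϖ0 : ϖ ≠ 0 := hprime.ne_zero
  -- saturation: `wp = ϖ^m • s₀`, `wT = T^m • s₀`
  obtain ⟨s₀, hs₀⟩ := exists_eq_pow_smul_of_smul_eq_pow_smul hprime (not_C_dvd_X_pow p m) m hw
  have hwT : wT = (PowerSeries.X : IwasawaAlgebra p) ^ m • s₀ := eq_smul_of_smul_eq_pow_smul hϖ0 m hw hs₀
  refine ⟨s₀, hs₀, hwT, ?_, ?_⟩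
  · -- value clause: `ϖ^m * G = loc (a • wp) = ϖ^m * (a * loc s₀)`, cancel `ϖ^m` in the domain `Λ`
    obtain ⟨y, hy, hyG⟩ := hval
    obtain ⟨a, rfl⟩ := Submodule.mem_span_singleton.mp hy
    refine ⟨a • s₀, Submodule.mem_span_singleton.mpr ⟨a, rfl⟩, ?_⟩
    have h1 : ((P.subtype ∘ₗ loc) (a • wp) : IwasawaAlgebra p) = ϖ ^ m * (P.subtype ∘ₗ loc) (a • s₀) := by
      rw [hs₀, smul_smul, mul_comm a, ← smul_smul, map_smul, smul_eq_mul]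
    have h2 : ϖ ^ m * G = ϖ ^ m * (P.subtype ∘ₗ loc) (a • s₀) := by rw [← hyG, h1]
    exact (mul_left_cancel₀ (pow_ne_zero m hϖ0) h2).symm
  · -- local clause: multiplier `M * ϖ^m ∉ 𝔭`
    intro 𝔭 h𝔭 hϖ𝔭
    obtain ⟨M, s, hM, hE, hs, hMs⟩ := hloc 𝔭 h𝔭 hϖ𝔭
    refine ⟨M * ϖ ^ m, s, ?_, hE, hs, ?_⟩
    · intro hmem
      rcases 𝔭.isPrime.mem_or_mem hmem with hM' | hpow
      · exact hM hM'
      · exact hϖ𝔭 (𝔭.isPrime.mem_of_pow_mem m hpow)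
    · rw [← hMs, hs₀, smul_smul]

/-- ★★ **The zeta line at `2` from its finite-index shadow, ON THE HABITAT** (`GoodSS W 2`; the cyclotomic `(κ, γ)`; the tree's pinned
`𝐇¹_Γ(T₂W) = I.H`).  Inputs = the FZ2 data of a prover of `stub_flatPackage`: `m`, integral `wp wT` with `T^m • wp = 2^m • wT` (Kato Thm. 12.6:
`𝔪^m Z(f,T) ⊂ Z ⊂ 𝐇¹`), the value clause up to `2^m` (`hval`) and the local Euler-multiple clause for `wp` at the height-one `𝔭 ∌ 2` (`hloc`,
§13.12).  Output = LITERALLY the shape of the registry's conjuncts «`G ∈ Submodule.map (P.subtype ∘ₗ loc) Z`» and ZL2 («`∃ s₀, Z = Λ∙s₀ ∧ ∀ 𝔭 …,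
∃ M ∉ 𝔭, ∃ s, IsEulerSystemClassTwo s ∧ s ≠ 0 ∧ M • s₀ = s`») of `stub_flatPackage` (line `odd_blind_package` v2.16, l.1652–1659), with
`Z := Λ∙s₀`.  Freeness from §1, torsion-freeness = tree `IwasawaH1Data.isTorsionFree` (Thm. 12.4 (2)).  Kato §13.14 = Wuthrich Lemma 12 AT `p = 2`.
[cite: Kato2004Asterisque, Thm. 12.4 (2)(3) (p. 221), Thm. 12.5 (4) and Thm. 12.6 (p. 222), §13.14 (p. 234)] [cite: Wuthrich2014, Lemma 12 and Thm. 13] -/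
theorem zetaLineAtTwo_of_finiteIndex (W : WeierstrassCurve ℚ) [W.IsElliptic] [W.IsGloballyMinimal]
    [ContinuousSMul ℤ_[2] (W.tateModule 2)] [Module.Free ℤ_[2] (W.tateModule 2)] [Module.Finite ℤ_[2] (W.tateModule 2)]
    (hss : GoodSS W 2) {κ : ZpExtension ℚ 2} {γ : Field.absoluteGaloisGroup ℚ} (hκ : κ.IsCyclotomic)
    (hγ : κ.IsTopGenerator γ) (I : Kato2004.IwasawaH1Data W 2 κ γ)
    (P : Submodule (IwasawaAlgebra 2) (IwasawaAlgebra 2)) (loc : I.H →ₗ[IwasawaAlgebra 2] P)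
    (G : IwasawaAlgebra 2) (m : ℕ) (wp wT : I.H)
    (hw : (PowerSeries.X : IwasawaAlgebra 2) ^ m • wp = (PowerSeries.C (2 : ℤ_[2]) : IwasawaAlgebra 2) ^ m • wT)
    (hval : (PowerSeries.C (2 : ℤ_[2]) : IwasawaAlgebra 2) ^ m * G ∈
      Submodule.map (P.subtype ∘ₗ loc) (Submodule.span (IwasawaAlgebra 2) {wp}))
    (hloc : ∀ 𝔭 : PrimeSpectrum (IwasawaAlgebra 2), 𝔭.asIdeal.height = 1 →
      PowerSeries.C (2 : ℤ_[2]) ∉ 𝔭.asIdeal →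
      ∃ (M : IwasawaAlgebra 2) (s : I.H), M ∉ 𝔭.asIdeal ∧
        Literature.NumberTheory.EllipticCurves.Kato2004.IsEulerSystemClassTwo W hκ I s ∧ s ≠ 0 ∧ M • wp = s) :
    ∃ Z : Submodule (IwasawaAlgebra 2) I.H,
      G ∈ Submodule.map (P.subtype ∘ₗ loc) Z ∧
      (∃ s₀ : I.H, Z = Submodule.span (IwasawaAlgebra 2) {s₀} ∧
        ∀ 𝔭 : PrimeSpectrum (IwasawaAlgebra 2), 𝔭.asIdeal.height = 1 →
          PowerSeries.C (2 : ℤ_[2]) ∉ 𝔭.asIdeal →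
          ∃ (M : IwasawaAlgebra 2) (s : I.H), M ∉ 𝔭.asIdeal ∧
            Literature.NumberTheory.EllipticCurves.Kato2004.IsEulerSystemClassTwo W hκ I s ∧ s ≠ 0 ∧
            M • s₀ = s) := by
  haveI := moduleFree_iwasawaH1_of_goodSS_two W hss hκ hγ I
  haveI := I.isTorsionFree hγ
  obtain ⟨s₀, -, -, hG, hloc'⟩ := zetaLine_of_finiteIndex P loc
    (Literature.NumberTheory.EllipticCurves.Kato2004.IsEulerSystemClassTwo W hκ I) G m wp wT hw hval hloc
  exact ⟨Submodule.span (IwasawaAlgebra 2) {s₀}, hG, s₀, rfl, hloc'⟩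

/-- **The saturating generator is pinned**: with the data of `zetaLineAtTwo_of_finiteIndex`, the integral `s₀` with `wp = 2^m • s₀` is UNIQUE and
also satisfies `wT = T^m • s₀` (so the zeta line `Λ∙s₀ ⊂ 𝐇¹_Γ` does not depend on the exponent `m` chosen). [cite: Kato2004Asterisque, §13.14 (p. 234)] -/
theorem existsUnique_generator_of_finiteIndex (W : WeierstrassCurve ℚ) [W.IsElliptic] [W.IsGloballyMinimal]
    [ContinuousSMul ℤ_[2] (W.tateModule 2)] (hss : GoodSS W 2) {κ : ZpExtension ℚ 2}
    {γ : Field.absoluteGaloisGroup ℚ} (hκ : κ.IsCyclotomic) (hγ : κ.IsTopGenerator γ)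
    (I : Kato2004.IwasawaH1Data W 2 κ γ) (m : ℕ) (wp wT : I.H)
    (hw : (PowerSeries.X : IwasawaAlgebra 2) ^ m • wp = (PowerSeries.C (2 : ℤ_[2]) : IwasawaAlgebra 2) ^ m • wT) :
    ∃! s₀ : I.H, wp = (PowerSeries.C (2 : ℤ_[2]) : IwasawaAlgebra 2) ^ m • s₀ ∧
      wT = (PowerSeries.X : IwasawaAlgebra 2) ^ m • s₀ := by
  haveI := moduleFree_iwasawaH1_of_goodSS_two W hss hκ hγ I
  haveI := I.isTorsionFree hγ
  have hprime : Prime (PowerSeries.C (2 : ℤ_[2]) : IwasawaAlgebra 2) :=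
    Literature.NumberTheory.EllipticCurves.IwasawaAlgebra.prime_C 2
  obtain ⟨s₀, hs₀⟩ := exists_eq_pow_smul_of_smul_eq_pow_smul hprime (not_C_dvd_X_pow 2 m) m hw
  refine ⟨s₀, ⟨hs₀, eq_smul_of_smul_eq_pow_smul hprime.ne_zero m hw hs₀⟩, ?_⟩
  rintro s ⟨hs, -⟩
  exact (saturate_unique hprime.ne_zero m hs₀ hs).symm

/-! ## §4 Tightness: FREENESS (Kato 12.4 (3)), not torsion-freeness (12.4 (2)), is what (E2) consumes -/

/-- **The saturation fails in a torsion-free NON-free `Λ`-module**: in `𝔪 = (2, T) ⊂ Λ = ℤ₂⟦T⟧` the elements `wp = 2`, `wT = T` satisfy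
`T • wp = 2 • wT`, yet no `s₀ ∈ 𝔪` has `wp = 2 • s₀` (it would be `1 ∉ 𝔪`).  This is the precise sense of «`p ≠ 2`» in Thm. 12.5 (4): §13.14 needs
`𝐇¹(T)` FREE; for the full `O_λ[[ℤ₂^×]]`-module at `p = 2` freeness is not available (§12.1), for the `Δ`-trivial component it is (§1).
[cite: Kato2004Asterisque, §12.1 (pp. 219–220), Thm. 12.4 (2)(3) (p. 221), §13.14 (p. 234)] -/
theorem saturation_fails_without_freeness :
    ∃ (wp wT : ↥(Ideal.span ({PowerSeries.C (2 : ℤ_[2]), PowerSeries.X} : Set (IwasawaAlgebra 2)))),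
      (PowerSeries.X : IwasawaAlgebra 2) ^ 1 • wp = (PowerSeries.C (2 : ℤ_[2]) : IwasawaAlgebra 2) ^ 1 • wT ∧
      ¬ ∃ s₀ : ↥(Ideal.span ({PowerSeries.C (2 : ℤ_[2]), PowerSeries.X} : Set (IwasawaAlgebra 2))),
        wp = (PowerSeries.C (2 : ℤ_[2]) : IwasawaAlgebra 2) ^ 1 • s₀ := by
  have h2 : (PowerSeries.C (2 : ℤ_[2]) : IwasawaAlgebra 2) ∈
      Ideal.span ({PowerSeries.C (2 : ℤ_[2]), PowerSeries.X} : Set (IwasawaAlgebra 2)) :=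
    Ideal.subset_span (by simp)
  have hX : (PowerSeries.X : IwasawaAlgebra 2) ∈
      Ideal.span ({PowerSeries.C (2 : ℤ_[2]), PowerSeries.X} : Set (IwasawaAlgebra 2)) :=
    Ideal.subset_span (by simp)
  refine ⟨⟨_, h2⟩, ⟨_, hX⟩, ?_, ?_⟩
  · apply Subtype.ext
    simp only [pow_one, SetLike.val_smul, smul_eq_mul]
    exact mul_comm _ _
  · rintro ⟨s₀, hs₀⟩
    have hcoe : (PowerSeries.C (2 : ℤ_[2]) : IwasawaAlgebra 2) * 1 =
        PowerSeries.C (2 : ℤ_[2]) * (s₀ : IwasawaAlgebra 2) := by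
      have := congrArg Subtype.val hs₀
      simpa [pow_one, SetLike.val_smul, smul_eq_mul] using this
    have hne : (PowerSeries.C (2 : ℤ_[2]) : IwasawaAlgebra 2) ≠ 0 :=
      (Literature.NumberTheory.EllipticCurves.IwasawaAlgebra.prime_C 2).ne_zero
    have hs1 : (s₀ : IwasawaAlgebra 2) = 1 := (mul_left_cancel₀ hne hcoe).symm
    -- `𝔪 ≤` the maximal ideal of the local ring `Λ` (both generators are non-units), so `1 ∉ 𝔪`
    have hle : Ideal.span ({PowerSeries.C (2 : ℤ_[2]), PowerSeries.X} : Set (IwasawaAlgebra 2)) ≤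
        IsLocalRing.maximalIdeal (IwasawaAlgebra 2) := by
      rw [Ideal.span_le]
      rintro x hx
      simp only [Set.mem_insert_iff, Set.mem_singleton_iff] at hx
      rw [SetLike.mem_coe, IsLocalRing.mem_maximalIdeal, mem_nonunits_iff, PowerSeries.isUnit_iff_constantCoeff]
      rcases hx with rfl | rfl
      · rw [PowerSeries.constantCoeff_C]
        exact (PadicInt.prime_p (p := 2)).not_unit
      · rw [PowerSeries.constantCoeff_X]
        exact not_isUnit_zero
    have h1 : (1 : IwasawaAlgebra 2) ∈ IsLocalRing.maximalIdeal (IwasawaAlgebra 2) := hle (hs1 ▸ s₀.2)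
    exact (IsLocalRing.maximalIdeal.isMaximal (IwasawaAlgebra 2)).ne_top
      (Ideal.eq_top_of_isUnit_mem _ h1 isUnit_one)

end Summit.BirchSwinnertonDyer.BirchSwinnertonDyer.Theorems.ZetaLineFI

end
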